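import Literature.AlgebraicGeometry.Resolution.EmbeddedResolutionExcellentSurfaces
import Literature.AlgebraicGeometry.Resolution.EmbeddedResolution
import Literature.AlgebraicGeometry.Resolution.BlowupsProperProofs
import HarnessLib

/-!
# Resolution of an embedded integral surface from Cossart–Jannsen–Saito's embedded theorem (Thm. 1.4, `B = ∅`)

Topic: `Literature/AlgebraicGeometry/Resolution` (proofs only: no new notions, no new named facts).

The named fact `CossartJannsenSaito2020Embedded` (`EmbeddedResolutionExcellentSurfaces.lean`; CJS 2020,
Thm. 1.4 with `B = ∅`) is vendored with centres "lying over `i(X)`" (`IsEmbeddedTransform (range i) (range i) π X₁`),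
which is weaker than print (the printed centres lie in the singular loci of the strict transforms) and allows
the degenerate sequences in which some centre swallows the strict transform of an irreducible `X` (after which
the iterated strict transform `X₁` is EMPTY).  This file proves:

* `IsEmbeddedTransform.sdiff_singleton` — for an irreducible closed `Y = closure {ξ}` and a composite of
  blow-ups with regular centres over `T` whose iterated strict transform of `Y` is NONEMPTY, no centre meets the
  fibre over `ξ`: the same data is an embedded transform with centres over `T ∖ {ξ}` (induction along the
  sequence: as long as the strict transform is `closure {ξ'}` with `ξ'` the unique point over `ξ`, a centre through
  a point over `ξ` contains `ξ'`, hence the whole strict transform, and kills it);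
* `hasResolution_of_isEmbeddedTransform_of_nonempty` — BGMW's "embedded desingularization ⇒ desingularization"
  (`hasResolution_of_isEmbeddedTransform`, which asks `ι(ξ) ∉ T`) for centres over ALL of `ι(Y)` provided the
  strict transform is nonempty;
* `hasResolution_of_embeddedTransform_of_isRegular` — the same with `Stacks02NS` discharged (`stacks02NS_holds`),
  in the shape of the datum `(Z₁, π, X₁, B₁)` produced by `CossartJannsenSaito2020Embedded` for a closed immersion
  `i : X ↪ Z` of an integral scheme into a Noetherian scheme: nonempty iterated strict transform `X₁` with regular
  reduced structure ⇒ `Scheme.HasResolution X` (the non-emptiness is automatic when `codim_Z X ≥ 2` at the generic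
  point — sequel file).

Purpose (Cossart–Piltant 2019 bookkeeping, crux `CleanModels` of the summit `ResolutionOfSingularities`): to serve the
NON-embedded uses of resolution of excellent surfaces in CP 2019's architecture (the rank-one reduction (C5) of
Prop. 4.10, `ArithmeticalThreefoldsLocalRankReduction.lean`, keyed so far on `CossartJannsenSaito2020General`) from
the EMBEDDED theorem alone.

## Sources

* V. Cossart, U. Jannsen, S. Saito, *Desingularization: Invariants and Strategy*, LNM 2270 (2020), Thm. 1.4 and
  p. 7 (proof of Cor. 1.5). [CossartJannsenSaito2020]
* E. Bierstone, D. Grigoriev, P. Milman, J. Włodarczyk, *Effective Hironaka resolution and its complexity*,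
  Asian J. Math. 15 (2011), §3.3 (3)⇒(4), Thm. 2.0.3. [BierstoneGrigorievMilmanWlodarczyk2011]
-/

noncomputable section

open CategoryTheory CategoryTheory.Limits AlgebraicGeometry TopologicalSpace Topology

namespace Literature.AlgebraicGeometry.Resolution

universe u

open Scheme.IdealSheafData

/-! ## Centres of a non-degenerate sequence avoid the generic fibre -/

/-- **Non-degenerate embedded transforms of an irreducible closed set have centres off the generic fibre.**
Let `σ : X' ⟶ X` be a composite of blow-ups with regular centres lying over `T ⊆ X` (`X` locally
Noetherian, blow-ups proper: `Stacks02NS`) and `Y' ⊆ X'` the iterated strict transform of the irreducible closed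
set `closure {ξ}`.  If `Y'` is nonempty, then every centre lies over `T ∖ {ξ}`.  Induction along the sequence:
while the centres avoid the fibre over `ξ`, the composite is an isomorphism over an open neighbourhood of `ξ`,
the strict transform is `closure {ξ'}` for the unique point `ξ'` over `ξ` (`IsEmbeddedTransform.isProper_and_exists`),
and a regular centre containing a point over `ξ` contains `ξ'`, hence all of `closure {ξ'}`, so that the next
strict transform `closure (τ⁻¹(Y' ∖ centre))` is empty — the reduction of "centres over `Y`" to BGMW's hypothesis
"centres disjoint from the generic point of `Y`" in their (3)⇒(4).
[cite: BierstoneGrigorievMilmanWlodarczyk2011, §3.3 (3)⇒(4) with Thm. 2.0.2 (2)] -/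
theorem IsEmbeddedTransform.sdiff_singleton (hB : Stacks02NS.{u}) {X : Scheme.{u}} [IsLocallyNoetherian X]
    {T : Set X} {ξ : X} {X' : Scheme.{u}} {σ : X' ⟶ X} {Y' : Set X'}
    (h : IsEmbeddedTransform (closure {ξ}) T σ Y') (hne : Y'.Nonempty) :
    IsEmbeddedTransform (closure {ξ}) (T \ {ξ}) σ Y' := by
  induction h with
  | refl => exact IsEmbeddedTransform.refl
  | @blowup X' X'' σ Y' h C τ hτ hC hT ih =>
    -- the previous strict transform is nonempty, so the induction hypothesis applies to it
    have hne' : Y'.Nonempty := by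
      by_contra h0
      rw [Set.not_nonempty_iff_eq_empty] at h0
      rw [h0, Set.empty_sdiff, Set.preimage_empty, closure_empty] at hne
      exact Set.not_nonempty_empty hne
    have ih' := ih hne'
    refine IsEmbeddedTransform.blowup ih' C τ hτ hC ?_
    -- the new centre lies over `T ∖ {ξ}`: a point of the centre over `ξ` would kill the strict transform
    rintro _ ⟨c, hc, rfl⟩
    refine ⟨hT ⟨c, hc, rfl⟩, fun hcξ => ?_⟩
    have hξT : ξ ∉ T \ {ξ} := fun h' => h'.2 rfl
    obtain ⟨-, V, hTV, hiso, ξ', hξ', hY'⟩ := ih'.isProper_and_exists hB hξT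
    have hξV : ξ ∈ V := hTV hξT
    obtain ⟨x, -, huniq⟩ := existsUnique_preimage_of_isIso_morphismRestrict σ hiso hξV
    have hcξ' : c = ξ' := (huniq c hcξ).trans (huniq ξ' hξ').symm
    -- `closure {ξ'} ⊆ centre`, so the strict transform dies
    have hsub : Y' ⊆ (C.support : Set X') := by
      rw [hY']
      exact closure_minimal (Set.singleton_subset_iff.mpr (hcξ' ▸ hc)) C.support.isClosed
    have hempty : Y' \ (C.support : Set X') = ∅ := Set.sdiff_eq_empty.mpr hsub
    rw [hempty, Set.preimage_empty, closure_empty] at hne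
    exact Set.not_nonempty_empty hne

/-! ## Embedded desingularization with centres over the whole subscheme -/

/-- **Embedded desingularization ⇒ resolution, centres over all of `ι(Y)`.** Let `ι : Y ↪ X` be a closed
immersion of an integral scheme into a locally Noetherian scheme, `σ : X' ⟶ X` a composite of blow-ups with
regular centres lying over `ι(Y)` and `Y' ⊆ X'` the iterated strict transform of `ι(Y)`.  If `Y'` is NONEMPTY and
its reduced closed subscheme structure (on `closure Y'`) is regular, then `Y` admits a resolution of singularities:
by `IsEmbeddedTransform.sdiff_singleton` the centres lie over `ι(Y) ∖ {ι(η_Y)}`, and BGMW's (3)⇒(4)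
(`hasResolution_of_isEmbeddedTransform`) applies.
[cite: BierstoneGrigorievMilmanWlodarczyk2011, §3.3 (3)⇒(4) and Thm. 2.0.3] -/
theorem hasResolution_of_isEmbeddedTransform_of_nonempty (hB : Stacks02NS.{u}) {X Y X' : Scheme.{u}}
    [IsLocallyNoetherian X] [IsIntegral Y] (ι : Y ⟶ X) [IsClosedImmersion ι]
    {σ : X' ⟶ X} {Y' : Set X'} (h : IsEmbeddedTransform (Set.range ι) (Set.range ι) σ Y')
    (hne : Y'.Nonempty)
    (hreg : Scheme.IsRegular
      (vanishingIdeal (⟨closure Y', isClosed_closure⟩ : Closeds X')).subscheme) :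
    Scheme.HasResolution Y := by
  set ξ : X := ι (genericPoint Y) with hξdef
  have hgen : IsGenericPoint ξ (Set.range ι) := by
    have := (genericPoint_spec Y).image ι.continuous
    rwa [Set.image_univ, ι.isClosedEmbedding.isClosed_range.closure_eq] at this
  have hYξ : Set.range ι = closure {ξ} := hgen.symm
  have h' : IsEmbeddedTransform (closure {ξ}) (Set.range ι) σ Y' := hYξ ▸ h
  have h'' := h'.sdiff_singleton hB hne
  rw [← hYξ] at h''
  exact hasResolution_of_isEmbeddedTransform hB ι (T := Set.range ι \ {ξ}) (fun hm => hm.2 rfl) h'' hreg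

/-- **Cossart–Jannsen–Saito Thm. 1.4 (`B = ∅`) ⇒ resolution of embedded integral surfaces, non-degenerate data.**
From `CossartJannsenSaito2020Embedded`: for a closed immersion `i : X ↪ Z` of an integral scheme of dimension `≤ 2`
into a Noetherian regular excellent scheme, if the embedded-resolution datum produced by the fact for `i` can be
taken with NONEMPTY iterated strict transform `X₁` — stated here as: every property the fact asserts of
`(Z₁, π, X₁, B₁)` holds for some datum with `X₁` nonempty — then `X` admits a resolution of singularities
(`Scheme.HasResolution`: a proper birational morphism from a regular scheme; the reduced strict transform works).
The hypothesis-free packaging for `codim ≥ 2` is in the sequel.  Blow-ups of locally Noetherian schemes are proper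
by the tree theorem `stacks02NS_holds`.
[cite: CossartJannsenSaito2020, Thm. 1.4 (pp. 5–6) and p. 7 (proof of Cor. 1.5)] -/
theorem hasResolution_of_embeddedTransform_of_isRegular {X Z : Scheme.{u}} (i : X ⟶ Z)
    [IsClosedImmersion i] [IsIntegral X] [IsNoetherian Z]
    {Z₁ : Scheme.{u}} {π : Z₁ ⟶ Z} {X₁ : Set Z₁}
    (hT : IsEmbeddedTransform (Set.range i) (Set.range i) π X₁) (hne : X₁.Nonempty)
    (hX₁ : Scheme.IsRegular (vanishingIdeal ⟨closure X₁, isClosed_closure⟩).subscheme) :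
    Scheme.HasResolution X :=
  hasResolution_of_isEmbeddedTransform_of_nonempty stacks02NS_holds i hT hne hX₁

end Literature.AlgebraicGeometry.Resolution

end
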